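import Summits.BirchSwinnertonDyer.BirchSwinnertonDyer.Theorems.BiquadraticEisensteinDescentEisensteinDivisibilityCMInertBadFlatAtOneOfPrintOfParts
import Summits.BirchSwinnertonDyer.BirchSwinnertonDyer.Theorems.BiquadraticEisensteinDescentEisensteinDivisibilityCMInertBadFlatAtOneAbsIrr
import HarnessLib

set_option linter.dupNamespace false -- `Summit.BirchSwinnertonDyer.BirchSwinnertonDyer.Theorems.…` (summit = sub)
set_option autoImplicit false

/-!
# Route `BiquadraticEisensteinDescent` (W-ALL row 12 · K12i), crux (E♭°) stmt-BirchSwinnertonDyer-20452 —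
# the threaded parent `EisensteinDivisibilityCMInertBadFlatAtOneOfPrint` (E10.sig) follows from the HEART ALONE

Cell `pub/bsd-wall`, prover seat `bsd-wall-bed-p2` (g3), 2026-08-27. Two tree theorems compose:

* `…FlatAtOneOfPrintOfParts.ofPrint_of_heart_of_absIrr` (p524778, this seat): `<Heart.sig> → <AbsIrr9.sig> → <E10.sig>`, the
  tenure planner's rev-10β split glue BY VALUE;
* `…FlatAtOneAbsIrr.absIrrModPBaseChangeCMInert` (p526727, bed-p1 g3): `<AbsIrr9.sig>` is a THEOREM (two-Frobenius criterion;
  every framed mod-`p` Galois representation of `W/K′` is absolutely irreducible for CM `W`, `p ≥ 5` inert in the CM field and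
  additive, `K′` imaginary quadratic Heegner for `N_W`).

Hence `ofPrint_of_heart : <Heart.sig verbatim> → <E10.sig verbatim>`: after the freeze (2026-08-28T08:25:30Z) the planner may
promote the heart by a ONE-child β-restate (new crux := Heart.sig; `closes` consumes it through this theorem and the (A∞)/(B)/(R)
print inputs) instead of a 2-child split — the (Irr) child is no longer needed as an item. No `Theses.…` decl is named.

HONEST FRAMING: THEOREMS ONLY (0 definitions, 0 named facts, 0 `sorry`); an implication between spelled-out propositions; the heart
is OPEN research (NOT IN PRINT, bed-p1 g2 verdict: Hsieh JAMS 2014 Thm. 2 hypothesis (2) fails for `ψ_L`) and nothing is asserted about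
it; (A∞)/(B)/(R) remain antecedents of the conclusion. Supports, does not close, stmt-BirchSwinnertonDyer-20452.
References: [Hsieh2014] Thm. A, Thm. B (Doc. Math. 19 p. 712); [Hsieh2014JAMS] Thm. 2 p. 3; [BertoliniDarmonPrasanna2013] Thm. 5.5.
-/

noncomputable section

open scoped Classical NumberField

open PowerSeries NumberField IsDedekindDomain Field WeierstrassCurve
  Literature.NumberTheory.EllipticCurves Literature.NumberTheory.EllipticCurves.ModularForms
  Literature.NumberTheory.EllipticCurves.Rank1Residual
  Literature.NumberTheory.GaloisRepresentations
  Literature.NumberTheory.EllipticCurves.Hsieh2014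
  Summit.BirchSwinnertonDyer.Rank1Residual.X11b
  Summit.BirchSwinnertonDyer.Rank1Residual.X11b.AcSelmer Summit.BirchSwinnertonDyer.Rank1Residual.X11b.Halves
  Summit.BirchSwinnertonDyer.BirchSwinnertonDyer.Theorems.BiquadraticEisensteinDescentEisensteinDivisibilityCMInertBadFlatAtOneOfPrintOfParts
  Summit.BirchSwinnertonDyer.BirchSwinnertonDyer.Theorems.BiquadraticEisensteinDescentEisensteinDivisibilityCMInertBadFlatAtOneAbsIrr

namespace Summit.BirchSwinnertonDyer.BirchSwinnertonDyer.Theorems.BiquadraticEisensteinDescentEisensteinDivisibilityCMInertBadFlatAtOneOfPrintOfHeart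

/-- **(E♭°) threaded ⟸ the heart alone.** If (heart = promoted `stub_E1B` with the `Λ`-torsion antecedent) for every
`R₀`-frame `L` at a datum of the CM inert-bad corner and every other prime `𝔭′ ∋ p` with `X_ac(W/K′)` strict at `𝔭′`
`Λ`-torsion, `p^m · Ch_Λ(X_ac) ⊆ (L)` for some `m`, then — granted (A∞) Hsieh Thm. A at any level, (B) Hsieh Thm. B at any
level and (R) BDP13 central-value reciprocity — at every datum with `Odd d_K′` and torsion `X_ac`, the constant terms of
`Ch_Λ(X_ac(W/K′), 𝔭′-strict)` lie in `Q(𝟙)·𝓞_{ℂ_p}` for every ♭-frame `Q`. Proof: `ofPrint_of_heart_of_absIrr` (p524778) with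
its (Irr) hypothesis DISCHARGED by bed-p1's theorem `absIrrModPBaseChangeCMInert` (p526727). CONDITIONAL on the heart (OPEN) and on
the three named facts in the conclusion's antecedent; unconditional in (Irr).
[cite: Hsieh2014, Thm. A and Thm. B p. 712 (Doc. Math. 19)] [cite: BertoliniDarmonPrasanna2013, Thm. 5.5 (p. 60)] -/
theorem ofPrint_of_heart
    (hHeart : ∀ (W : WeierstrassCurve ℚ) [W.IsElliptic] [W.IsGloballyMinimal] (p : ℕ) [Fact p.Prime]
      [NeZero (W.conductorNorm ℤ)] (K : Type) [Field K] [NumberField K],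
      W.HasCM → W.analyticRank = 1 → 5 ≤ p → CMInert W p → ¬ Good W p →
      IsImaginaryQuadratic K → SatisfiesHeegnerHypothesis (W.conductorNorm ℤ) K →
      4 < (NumberField.discr K).natAbs →
      (∀ (L : Type) [Field L] [NumberField L], Module.finrank ℚ L = 4 →
        (∃ x : L, x ^ 2 = ((cmFieldDiscrOfJ W.j : ℤ) : L)) → (∃ y : L, y ^ 2 = ((NumberField.discr K : ℤ) : L)) →
        ¬ p ∣ NumberField.classNumber L) →
      (W.quadraticTwist (NumberField.discr K : ℚ)).entireLFunction 1 ≠ 0 →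
      ∀ (κ : ZpExtension K p), κ.IsAnticyclotomic →
        ∀ (γ : Field.absoluteGaloisGroup K) [Fact (κ.IsTopGenerator γ)]
          (𝔭 : HeightOneSpectrum (𝓞 K)), ((p : ℕ) : 𝓞 K) ∈ 𝔭.asIdeal →
          𝔭.asIdeal.ramificationIdx (𝓞 ℚ) = 1 → 𝔭.asIdeal.inertiaDeg (𝓞 ℚ) = 1 →
          ∀ (f : CuspForm (CongruenceSubgroup.Gamma0 (W.conductorNorm ℤ)) 2), IsNewformOf W f →
            ∀ (ι' : PadicAlgCl p ≃+* ℂ),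
              (∀ (w : InfinitePlace K) (k : 𝓞 K), k ∈ 𝔭.asIdeal ↔ ‖ι'.symm (w.embedding (k : K))‖ < 1) →
              ∀ (ΩK : ℂ) (Ωp : (unrIntegers p)ˣ) (L : UnrSeries p), ΩK ≠ 0 →
                IsBDPLFunction ι' 𝔭 κ γ f ΩK ((Ωp : unrIntegers p) : ℂ_[p]) L →
                  ∀ (𝔭' : HeightOneSpectrum (𝓞 K)), ((p : ℕ) : 𝓞 K) ∈ 𝔭'.asIdeal → 𝔭' ≠ 𝔭 →
                  Module.IsTorsion (IwasawaAlgebra p) (XAc (W.baseChange K) p κ 𝔭' ∅ γ) →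
                  ∃ m : ℕ, ∀ x ∈ (XAc.charIdeal (W.baseChange K) p κ 𝔭' ∅ γ).map (PowerSeries.map (toUnr p)),
                    (PowerSeries.C ((p : ℕ) : unrIntegers p) : UnrSeries p) ^ m * x ∈ Ideal.span {L}) :
  thmA_exists_isHsiehLFunction_unrPeriod_anyLevel →
  thmB_exists_isHsiehLFunction_coeff_norm_eq_one_unrPeriod_anyLevel →
  bertoliniDarmonPrasanna2013_centralValue_reciprocity →
  ∀ (W : WeierstrassCurve ℚ) [W.IsElliptic] [W.IsGloballyMinimal] (p : ℕ) [Fact p.Prime]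
    [NeZero (W.conductorNorm ℤ)] (K : Type) [Field K] [NumberField K],
    W.HasCM → W.analyticRank = 1 → 5 ≤ p → CMInert W p → ¬ Good W p →
    IsImaginaryQuadratic K → SatisfiesHeegnerHypothesis (W.conductorNorm ℤ) K →
    Odd (NumberField.discr K) →
    4 < (NumberField.discr K).natAbs →
    (∀ (L : Type) [Field L] [NumberField L], Module.finrank ℚ L = 4 →
      (∃ x : L, x ^ 2 = ((cmFieldDiscrOfJ W.j : ℤ) : L)) → (∃ y : L, y ^ 2 = ((NumberField.discr K : ℤ) : L)) →
      ¬ p ∣ NumberField.classNumber L) →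
    (W.quadraticTwist (NumberField.discr K : ℚ)).entireLFunction 1 ≠ 0 →
    ∀ (κ : ZpExtension K p), κ.IsAnticyclotomic →
      ∀ (γ : Field.absoluteGaloisGroup K) [Fact (κ.IsTopGenerator γ)]
        (𝔭 : HeightOneSpectrum (𝓞 K)), ((p : ℕ) : 𝓞 K) ∈ 𝔭.asIdeal →
        𝔭.asIdeal.ramificationIdx (𝓞 ℚ) = 1 → 𝔭.asIdeal.inertiaDeg (𝓞 ℚ) = 1 →
        ∀ (𝔭' : HeightOneSpectrum (𝓞 K)), ((p : ℕ) : 𝓞 K) ∈ 𝔭'.asIdeal → 𝔭' ≠ 𝔭 →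
        Module.IsTorsion (IwasawaAlgebra p) (XAc (W.baseChange K) p κ 𝔭' ∅ γ) →
        ∀ (f : CuspForm (CongruenceSubgroup.Gamma0 (W.conductorNorm ℤ)) 2), IsNewformOf W f →
          ∀ (ι' : PadicAlgCl p ≃+* ℂ),
            (∀ (w : InfinitePlace K) (k : 𝓞 K), k ∈ 𝔭.asIdeal ↔ ‖ι'.symm (w.embedding (k : K))‖ < 1) →
            ∀ (ΩK : ℂ) (Ωp : (unrIntegers p)ˣ) (Q : PowerSeries (PadicComplexInt p)), ΩK ≠ 0 →
              R1.IsBDPLFunctionInt p ι' 𝔭 κ γ f ΩK ((Ωp : unrIntegers p) : (PadicComplex p)) Q →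
                (XAc.charIdeal (W.baseChange K) p κ 𝔭' ∅ γ).map
                    ((R1.toCpInt p).comp (PowerSeries.constantCoeff : IwasawaAlgebra p →+* ℤ_[p])) ≤
                  Ideal.span {PowerSeries.constantCoeff Q} :=
  ofPrint_of_heart_of_absIrr hHeart absIrrModPBaseChangeCMInert

end Summit.BirchSwinnertonDyer.BirchSwinnertonDyer.Theorems.BiquadraticEisensteinDescentEisensteinDivisibilityCMInertBadFlatAtOneOfPrintOfHeart

end
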